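import Literature.Computability.AlgebraicComplexity.QuantumFunctionalsUpper
import Literature.NumberTheory.DiophantineGeometry.KroneckerSemigroup
import Literature.NumberTheory.DiophantineGeometry.SymmetricGroupRepsIrreducibleProofs
import Literature.NumberTheory.DiophantineGeometry.SymmetricGroupRepsFinrankSpechtProofs
import Literature.NumberTheory.DiophantineGeometry.PartitionTableauxProofs
import Literature.NumberTheory.DiophantineGeometry.GLHighestWeightFacts
import Mathlib.Analysis.SpecialFunctions.Stirling
import Mathlib.Data.List.GetD
import HarnessLib

/-!
# Dimension bounds for `[λ]` (CVZ Rem. 3.7), the iterated semigroup property (Rem. 3.9) and the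
# `N → ∞` step of the printed proof of CVZ Lemma 3.10.1

Topic `Literature/Computability/AlgebraicComplexity`; a theorems-only toolkit for §3.1 of
Christandl–Vrana–Zuiddam, *Universal points in the asymptotic spectrum of tensors*, J. Amer. Math.
Soc. 36 (2023) = arXiv:1709.07851v3 (the representation-theoretic estimates behind the upper
quantum functional `F^θ` of `QuantumFunctionalsUpper.lean`). It formalises, on top of the tree's
symmetric-group theory, the PRINTED route to Lemma 3.10.1 ("if `g_{λ,μ,ν}` is nonzero, then
`H(λ̄) ≤ H(μ̄) + H(ν̄)`", p. 13: "The semigroup property of Kronecker coefficients implies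
`g_{Nλ,Nμ,Nν} ≠ 0` for any positive integer `N` … the irreducible representation `[Nλ]` is
isomorphic to a subspace of `[Nμ] ⊗ [Nν]` … So obviously `dim[Nλ] ≤ dim[Nμ] dim[Nν]`. We use the
dimension bounds (3.7) to see that `Nn H(λ̄) - o(N) ≤ Nn H(μ̄) + Nn H(ν̄)` when `N → ∞`"), whose
four ingredients are of independent use (Rem. 3.7 is also used by the spectrum estimation
Thm. 3.27 and by Lemma 3.10.2/Lemma 3.11):

1. **`dim[λ] ≤ dim[μ] dim[ν]` when `g_{λ,μ,ν} ≠ 0`**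
   (`numStandardTableaux_le_mul_of_kroneckerCoeff_ne_zero`, §1): the tree's
   `kroneckerCoeff ℂ μ ν λ = dim Hom_{S_n}(S^μ ⊗ S^ν, S^λ)` (`SymmetricGroupReps.lean`), so `g ≠ 0`
   gives a nonzero intertwiner `S^μ ⊗ S^ν → S^λ`, surjective since `S^λ` is irreducible
   (`isIrreducible_spechtRep_holds`; Mathlib's `Representation.IsIrreducible`), whence
   `dim S^λ ≤ dim S^μ · dim S^ν`, and `dim S^κ = f^κ` (`finrank_spechtIdeal_holds`).
2. **Dimension bounds, Rem. 3.7 (3.7)**: "`n!/∏_ℓ (λ_ℓ + d - ℓ)! ≤ dim[λ] ≤ n!/∏_ℓ λ_ℓ!`", from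
   the hook-length formula `f^λ ∏_c h(c) = n!` (`numStandardTableaux_mul_prod_hookLength_holds`,
   `PartitionTableauxProofs.lean`): the hooks in row `i` satisfy `λᵢ - j ≤ h(i,j) ≤ λᵢ - j + L - 1`
   for any `L ≥ ℓ(λ)`, so `f^λ ∏ᵢ λᵢ! ≤ n!` (`numStandardTableaux_mul_prod_factorial_le`) and
   `n! ≤ f^λ ∏ᵢ (λᵢ + L)!` (`factorial_le_numStandardTableaux_mul_prod`, the slightly cruder
   `(λᵢ + L)!` in place of `(λᵢ + d - i)!`, which is all the limit needs) (§2).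
3. **Semigroup property, iterated** (`kroneckerCoeff_pos_of_parts_eq_map_mul`, §3):
   `g_{Nλ,Nμ,Nν} > 0` for all `N ≥ 1`, by induction from the tree's theorem
   `kroneckerCoeff_pos_of_ofPartition_add` (`KroneckerSemigroup.lean`, the highest-weight-vector
   proof of the semigroup property, Christandl–Harrow–Mitchison 2007 / Ikenmeyer–Panova 2017
   §1.1) applied to `(Nλ, λ)`; the stretched partition `Nλ` (parts `Nλᵢ`, weight `N · wt(λ)`)
   exists by `exists_parts_eq_map_mul`.
4. **The limit `N → ∞`** (`entropy_core_le`, §4): 1–3 give, for every `N ≥ 1`,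
   `(Nn)! ∏ᵢ(Nμᵢ)! ∏ᵢ(Nνᵢ)! ≤ (Nn)!² ∏ᵢ(Nλᵢ + n)!`; with the effective Stirling bounds
   `m log m - m ≤ log m! ≤ m log m - m + ½ log m + 1` (`mul_log_sub_self_le_log_factorial`,
   `log_factorial_le`, from Mathlib's `Stirling.le_log_factorial_stirling` and the antitonicity of
   `Stirling.stirlingSeq`) this reads `N · (E(λ) - E(μ) - E(ν)) ≤ C log(nN + n) + C'` with
   `E(κ) = n log n - ∑ κᵢ log κᵢ = n (ln 2) H(κ̄)` (`partitionEntropy_eq_div`, §5), and `log` is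
   sublinear (`nonpos_of_mul_natCast_le_log`, the "`o(N)`"), so `E(λ) ≤ E(μ) + E(ν)`.

The discharge `ChristandlVranaZuiddam2023_entropy_le_of_kroneckerCoeff_holds` itself lives in
`QuantumFunctionalsUpperKroneckerEntropyProofs.lean` (an elementary contingency-table/Karamata
proof avoiding the semigroup property, landed first); this file does not restate it.
Theorems only: no definitions, no named facts.

## References

* M. Christandl, P. Vrana, J. Zuiddam, *Universal points in the asymptotic spectrum of tensors*,
  J. Amer. Math. Soc. 36 (2023) 31–79 = arXiv:1709.07851v3, Rem. 3.7 (3.7), Def. 3.8 (krondef),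
  Rem. 3.9, Lemma 3.10 and its proof (p. 13). [ChristandlVranaZuiddam2023]
* M. Christandl, A. W. Harrow, G. Mitchison, Comm. Math. Phys. 270 (2007) 575–585 (semigroup
  property); C. Ikenmeyer, G. Panova, Adv. Math. 319 (2017), §1.1. [IkenmeyerPanova2017]
* J. S. Frame, G. de B. Robinson, R. M. Thrall, Canad. J. Math. 6 (1954) (hook length formula).
  [FrameRobinsonThrallCJM1954]

## Mathlib and tree

Mathlib: `Representation.IsIrreducible`, `Representation.IntertwiningMap.range`,
`Module.finrank_tensorProduct`, `LinearMap.finrank_range_le`, `Finset.prod_finset_product'`,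
`YoungDiagram.*`, `List.Perm.eq_of_sortedGE`, `Stirling.le_log_factorial_stirling`,
`Stirling.log_stirlingSeq'_antitone`, `Stirling.log_stirlingSeq_formula`, `Real.log_le_sub_one_of_pos`,
`Multiset.map_univ`. Tree: `kroneckerCoeff`, `spechtRep`, `isIrreducible_spechtRep_holds`,
`finrank_spechtIdeal_holds`, `numStandardTableaux_mul_prod_hookLength_holds`, `hookLength`,
`Nat.Partition.youngDiagram`/`sortedParts`, `Weight.ofPartition`,
`kroneckerCoeff_pos_of_ofPartition_add`, `partitionEntropy`.
-/

noncomputable section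

open scoped BigOperators

namespace Literature.Computability.AlgebraicComplexity

open Literature.NumberTheory.DiophantineGeometry


/-! ## §1 `dim[λ] ≤ dim[μ] · dim[ν]` when `g_{λ,μ,ν} ≠ 0` -/

section DimBound

variable {n : ℕ}

/-- **"`[λ]` is isomorphic to a subspace of `[μ] ⊗ [ν]`, so `dim[λ] ≤ dim[μ] dim[ν]`"** (CVZ, proof
of Lemma 3.10): if `g_{λ,μ,ν} = dim Hom_{S_n}(S^μ ⊗ S^ν, S^λ) ≠ 0` then `f^λ ≤ f^μ f^ν`. A nonzero
intertwiner `S^μ ⊗ S^ν → S^λ` is surjective because `S^λ` is irreducible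
(`isIrreducible_spechtRep_holds`), and `dim S^κ = f^κ` (`finrank_spechtIdeal_holds`).
[cite: ChristandlVranaZuiddam2023, Lemma 3.10 (proof)] -/
theorem numStandardTableaux_le_mul_of_kroneckerCoeff_ne_zero {lam mu nu : Nat.Partition n}
    (h : kroneckerCoeff ℂ mu nu lam ≠ 0) :
    numStandardTableaux lam ≤ numStandardTableaux mu * numStandardTableaux nu := by
  haveI : Nontrivial (((spechtRep ℂ mu).tprod (spechtRep ℂ nu)).IntertwiningMap (spechtRep ℂ lam)) :=
    Module.nontrivial_of_finrank_pos (R := ℂ) (Nat.pos_of_ne_zero h)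
  obtain ⟨f, hf⟩ := exists_ne (0 : ((spechtRep ℂ mu).tprod (spechtRep ℂ nu)).IntertwiningMap
    (spechtRep ℂ lam))
  haveI : (spechtRep ℂ lam).IsIrreducible := isIrreducible_spechtRep_holds (k := ℂ) lam
  have hrange : f.range = ⊤ := by
    refine (IsSimpleOrder.eq_bot_or_eq_top f.range).resolve_left fun hbot => hf ?_
    refine Representation.IntertwiningMap.ext (LinearMap.ext fun v => ?_)
    have hv : f v ∈ f.range := ⟨v, rfl⟩
    rw [hbot] at hv
    change f v ∈ (⊥ : Submodule ℂ _) at hv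
    rw [Submodule.mem_bot] at hv
    exact hv
  have hsurj : LinearMap.range f.toLinearMap = ⊤ := congrArg Subrepresentation.toSubmodule hrange
  have key : Module.finrank ℂ (spechtIdeal ℂ lam) ≤
      Module.finrank ℂ (TensorProduct ℂ (spechtIdeal ℂ mu) (spechtIdeal ℂ nu)) := by
    rw [← finrank_top ℂ (spechtIdeal ℂ lam), ← hsurj]
    exact LinearMap.finrank_range_le f.toLinearMap
  rw [Module.finrank_tensorProduct, finrank_spechtIdeal_holds ℂ lam, finrank_spechtIdeal_holds ℂ mu,
    finrank_spechtIdeal_holds ℂ nu] at key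
  exact key

end DimBound

/-! ## §2 The dimension bounds of Rem. 3.7 from the hook-length formula -/

section Hook

variable {d : ℕ}

/-- A product over the boxes of a Young diagram, row by row (the rows are indexed by
`i < colLen 0`, row `i` being `{i} × [0, rowLen i)`). [folklore] -/
theorem prod_cells_eq_prod_rows (Y : YoungDiagram) (f : ℕ × ℕ → ℕ) :
    ∏ c ∈ Y.cells, f c =
      ∏ i ∈ Finset.range (Y.colLen 0), ∏ j ∈ Finset.range (Y.rowLen i), f (i, j) := by
  have key := Finset.prod_finset_product' (r := Y.cells) (s := Finset.range (Y.colLen 0))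
    (t := fun i => Finset.range (Y.rowLen i)) (f := fun i j => f (i, j)) ?_
  · simpa using key
  · rintro ⟨i, j⟩
    simp only [Finset.mem_range, YoungDiagram.mem_cells]
    constructor
    · intro h
      exact ⟨YoungDiagram.mem_iff_lt_colLen.1 (Y.up_left_mem le_rfl (Nat.zero_le j) h),
        YoungDiagram.mem_iff_lt_rowLen.1 h⟩
    · rintro ⟨-, h⟩
      exact YoungDiagram.mem_iff_lt_rowLen.2 h

/-- Lower hook bound: the hook of the box `(i, j)` contains the `λᵢ - j` boxes weakly to its
right, `λᵢ - j ≤ h(i, j)`. [cite: ChristandlVranaZuiddam2023, Rem. 3.7] -/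
theorem rowLen_sub_le_hookLength {Y : YoungDiagram} {i j : ℕ} (h : (i, j) ∈ Y) :
    Y.rowLen i - j ≤ hookLength Y (i, j) := by
  have h₁ : i < Y.colLen j := YoungDiagram.mem_iff_lt_colLen.1 h
  simp only [hookLength]
  omega

/-- Upper hook bound: if the diagram has at most `L` rows, the leg of the hook of `(i, j)` has
fewer than `L` boxes, `h(i, j) ≤ λᵢ - j + L - 1`. [cite: ChristandlVranaZuiddam2023, Rem. 3.7] -/
theorem hookLength_le {Y : YoungDiagram} {i j L : ℕ} (h : (i, j) ∈ Y) (hL : Y.colLen 0 ≤ L) :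
    hookLength Y (i, j) ≤ Y.rowLen i - j + L - 1 := by
  have h₁ : i < Y.colLen j := YoungDiagram.mem_iff_lt_colLen.1 h
  have h₂ : Y.colLen j ≤ Y.colLen 0 := Y.colLen_anti 0 j (Nat.zero_le j)
  simp only [hookLength]
  omega

/-- `∏_{j < r} (r - j) = r!`. [folklore] -/
theorem prod_range_sub_eq_factorial (r : ℕ) : ∏ j ∈ Finset.range r, (r - j) = r.factorial := by
  induction r with
  | zero => simp
  | succ r ih =>
    rw [Finset.prod_range_succ', Nat.factorial_succ, ← ih, mul_comm]
    simp

/-- `∏_{j < r} (r - j + L) ≤ (r + L)!` (the left side is `(r + L)!/L!`). [folklore] -/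
theorem prod_range_sub_add_le_factorial (r L : ℕ) :
    ∏ j ∈ Finset.range r, (r - j + L) ≤ (r + L).factorial := by
  induction r with
  | zero => simpa using Nat.one_le_iff_ne_zero.2 (Nat.factorial_ne_zero L)
  | succ r ih =>
    rw [Finset.prod_range_succ']
    have h1 : ∏ j ∈ Finset.range r, (r + 1 - (j + 1) + L) = ∏ j ∈ Finset.range r, (r - j + L) := by
      refine Finset.prod_congr rfl fun j _ => ?_
      congr 1
      omega
    rw [h1, show r + 1 + L = (r + L) + 1 by ring, Nat.factorial_succ, Nat.sub_zero, mul_comm]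
    exact Nat.mul_le_mul (by omega) ih

/-- A product over `range (length w)` of a function of the entries of a list `w` is the product
over the list. [folklore] -/
theorem prod_range_length_getD (w : List ℕ) (g : ℕ → ℕ) :
    ∏ i ∈ Finset.range w.length, g (w.getD i 0) = (w.map g).prod := by
  induction w with
  | nil => simp
  | cons a w ih =>
    rw [List.length_cons, Finset.prod_range_succ', List.map_cons, List.prod_cons]
    simp only [List.getD_cons_succ, List.getD_cons_zero]
    rw [ih, mul_comm]

/-- `∏_{p ∈ parts μ} g(p) = ∏_{i < ℓ(μ)} g(λᵢ)`, the rows of the Young diagram of `μ` having the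
sorted parts as lengths. [folklore] -/
theorem prod_map_parts_eq_prod_range (μ : Nat.Partition d) (g : ℕ → ℕ) :
    (μ.parts.map g).prod =
      ∏ i ∈ Finset.range (μ.youngDiagram.colLen 0), g (μ.youngDiagram.rowLen i) := by
  have hlen : μ.youngDiagram.colLen 0 = μ.sortedParts.length := by
    rw [← YoungDiagram.length_rowLens, μ.rowLens_youngDiagram]
  have hrow : ∀ i ∈ Finset.range μ.sortedParts.length,
      g (μ.youngDiagram.rowLen i) = g (μ.sortedParts.getD i 0) := by
    intro i hi
    rw [Finset.mem_range] at hi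
    have hi' : i < μ.youngDiagram.rowLens.length := by rwa [μ.rowLens_youngDiagram]
    have : μ.youngDiagram.rowLen i = μ.youngDiagram.rowLens.getD i 0 := by
      rw [List.getD_eq_getElem _ _ hi', YoungDiagram.get_rowLens]
    rw [this, μ.rowLens_youngDiagram]
  rw [hlen, Finset.prod_congr rfl hrow, prod_range_length_getD]
  have hs : (μ.sortedParts : Multiset ℕ) = μ.parts := Multiset.sort_eq _ _
  conv_lhs => rw [← hs]
  rw [Multiset.map_coe, Multiset.prod_coe]

/-- The Young diagram of `μ` has `ℓ(μ)` rows (this is `colLen_zero_youngDiagram` of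
`PlethysmHookVanishing.lean`, which is not imported here). [folklore] -/
theorem colLen_zero_eq_card_parts (μ : Nat.Partition d) :
    μ.youngDiagram.colLen 0 = μ.parts.card := by
  rw [← YoungDiagram.length_rowLens, μ.rowLens_youngDiagram, μ.length_sortedParts]

/-- **Dimension bound, upper** (CVZ Rem. 3.7 (3.7), right inequality `dim[λ] ≤ n!/∏_ℓ λ_ℓ!`), in
division-free form `f^λ · ∏_ℓ λ_ℓ! ≤ n!`: by the hook-length formula, the hooks in row `ℓ` have
lengths at least `λ_ℓ, λ_ℓ - 1, …, 1`. [cite: ChristandlVranaZuiddam2023, Rem. 3.7] -/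
theorem numStandardTableaux_mul_prod_factorial_le (μ : Nat.Partition d) :
    numStandardTableaux μ * (μ.parts.map Nat.factorial).prod ≤ d.factorial := by
  rw [← numStandardTableaux_mul_prod_hookLength_holds μ]
  refine Nat.mul_le_mul_left _ ?_
  rw [prod_map_parts_eq_prod_range, prod_cells_eq_prod_rows]
  refine Finset.prod_le_prod (fun i _ => Nat.zero_le _) fun i _ => ?_
  rw [← prod_range_sub_eq_factorial]
  refine Finset.prod_le_prod (fun j _ => Nat.zero_le _) fun j hj => ?_
  exact rowLen_sub_le_hookLength (YoungDiagram.mem_iff_lt_rowLen.2 (Finset.mem_range.1 hj))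

/-- **Dimension bound, lower** (CVZ Rem. 3.7 (3.7), left inequality
`n!/∏_ℓ (λ_ℓ + d - ℓ)! ≤ dim[λ]` for `λ ⊢_d n`), in the cruder division-free form
`n! ≤ f^λ · ∏_ℓ (λ_ℓ + L)!` for any `L ≥ ℓ(λ)`: the hooks in row `ℓ` have lengths at most
`λ_ℓ + L - 1, …, L`. [cite: ChristandlVranaZuiddam2023, Rem. 3.7] -/
theorem factorial_le_numStandardTableaux_mul_prod (μ : Nat.Partition d) {L : ℕ}
    (hL : μ.parts.card ≤ L) :
    d.factorial ≤ numStandardTableaux μ * (μ.parts.map fun p => (p + L).factorial).prod := by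
  rw [← numStandardTableaux_mul_prod_hookLength_holds μ]
  refine Nat.mul_le_mul_left _ ?_
  rw [prod_map_parts_eq_prod_range, prod_cells_eq_prod_rows]
  refine Finset.prod_le_prod (fun i _ => Nat.zero_le _) fun i _ => ?_
  refine le_trans ?_ (prod_range_sub_add_le_factorial _ L)
  refine Finset.prod_le_prod (fun j _ => Nat.zero_le _) fun j hj => ?_
  have hL' : μ.youngDiagram.colLen 0 ≤ L := (colLen_zero_eq_card_parts μ).le.trans hL
  have := hookLength_le (YoungDiagram.mem_iff_lt_rowLen.2 (Finset.mem_range.1 hj)) hL'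
  omega

end Hook

/-! ## §3 Stretched partitions `Nλ` and the iterated semigroup property -/

section Stretch

variable {n : ℕ}

/-- The stretched partition `Nλ`, "the partition with parts `Nλᵢ`" (CVZ, proof of Lemma 3.10),
exists for every `N ≥ 1` (as a partition of `Nn`; built with `Nat.Partition.ofSums`, no part being
zero). [cite: ChristandlVranaZuiddam2023, Lemma 3.10 (proof)] -/
theorem exists_parts_eq_map_mul (N : ℕ) (lam : Nat.Partition n) :
    ∃ P : Nat.Partition ((N + 1) * n), P.parts = lam.parts.map ((N + 1) * ·) := by
  refine ⟨Nat.Partition.ofSums ((N + 1) * n) (lam.parts.map ((N + 1) * ·))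
    (by rw [Multiset.sum_map_mul_left, Multiset.map_id', lam.parts_sum]), ?_⟩
  rw [Nat.Partition.ofSums_parts, Multiset.filter_eq_self]
  intro a ha
  obtain ⟨p, hp, rfl⟩ := Multiset.mem_map.1 ha
  exact mul_ne_zero (Nat.succ_ne_zero N) (lam.parts_pos hp).ne'

/-- The sorted parts of a partition whose parts are `c` times those of `λ` are `c` times the
sorted parts of `λ` (multiplication by `c` is monotone). [folklore] -/
theorem sortedParts_eq_map_of_parts_eq {m c : ℕ} {P : Nat.Partition m} {lam : Nat.Partition n}
    (hP : P.parts = lam.parts.map (c * ·)) : P.sortedParts = lam.sortedParts.map (c * ·) := by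
  refine List.Perm.eq_of_sortedGE P.sortedGE_sortedParts ?_ ?_
  · refine (List.pairwise_map.2 ?_).sortedGE
    exact lam.sortedGE_sortedParts.pairwise.imp fun {a b} (h : b ≤ a) => Nat.mul_le_mul_left c h
  · rw [← Multiset.coe_eq_coe, ← Multiset.map_coe]
    change (P.parts.sort (· ≥ ·) : Multiset ℕ) = Multiset.map _ (lam.parts.sort (· ≥ ·) : Multiset ℕ)
    rw [Multiset.sort_eq, Multiset.sort_eq, hP]

/-- The `GL_M`-weight of a partition with parts `cλᵢ` is `c` times the weight of `λ`. [folklore] -/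
theorem ofPartition_eq_smul_of_parts_eq (M : ℕ) {m c : ℕ} {P : Nat.Partition m}
    {lam : Nat.Partition n} (hP : P.parts = lam.parts.map (c * ·)) :
    Weight.ofPartition M P = c • Weight.ofPartition M lam := by
  funext i
  simp only [Weight.ofPartition_apply, Pi.smul_apply, sortedParts_eq_map_of_parts_eq hP, nsmul_eq_mul]
  have := List.getD_map (f := (c * ·)) (l := lam.sortedParts) (n := i) (d := 0)
  rw [mul_zero] at this
  rw [this]
  push_cast
  ring

/-- Kronecker coefficients only depend on the multisets of parts (transport along equal sizes).
[folklore] -/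
theorem kroneckerCoeff_eq_of_parts_eq {m m' : ℕ} {a b c : Nat.Partition m}
    {a' b' c' : Nat.Partition m'} (ha : a.parts = a'.parts) (hb : b.parts = b'.parts)
    (hc : c.parts = c'.parts) : kroneckerCoeff ℂ a b c = kroneckerCoeff ℂ a' b' c' := by
  obtain rfl : m = m' := by rw [← a.parts_sum, ha, a'.parts_sum]
  obtain rfl : a = a' := Nat.Partition.ext ha
  obtain rfl : b = b' := Nat.Partition.ext hb
  obtain rfl : c = c' := Nat.Partition.ext hc
  rfl

/-- A partition of `n` has at most `n` parts. [folklore] -/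
theorem card_parts_le (lam : Nat.Partition n) : lam.parts.card ≤ n := by
  have h : (lam.parts.map fun _ => 1).sum ≤ (lam.parts.map id).sum :=
    Multiset.sum_map_le_sum_map _ _ fun a ha => lam.parts_pos ha
  rw [Multiset.map_const', Multiset.sum_replicate, smul_eq_mul, mul_one, Multiset.map_id,
    lam.parts_sum] at h
  exact h

/-- **Iterated semigroup property** (CVZ Rem. 3.9 / proof of Lemma 3.10: "the semigroup property
of Kronecker coefficients implies `g_{Nλ,Nμ,Nν} ≠ 0` for any positive integer `N`, where `Nλ` is
the partition with parts `Nλᵢ`"), from the tree's theorem `kroneckerCoeff_pos_of_ofPartition_add`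
(the semigroup property, proved in `KroneckerSemigroup.lean`) by induction on `N`, the weight of
`(N+1)κ` being `wt(Nκ) + wt(κ)`; stated for any partitions `Λ, Μ, Ν` whose parts are the
`(N+1)λᵢ, (N+1)μᵢ, (N+1)νᵢ`. [cite: ChristandlVranaZuiddam2023, Rem. 3.9 and Lemma 3.10 (proof)] -/
theorem kroneckerCoeff_pos_of_parts_eq_map_mul {lam mu nu : Nat.Partition n}
    (h : 0 < kroneckerCoeff ℂ lam mu nu) (N : ℕ) {m : ℕ} {Lam Mu Nu : Nat.Partition m}
    (hL : Lam.parts = lam.parts.map ((N + 1) * ·)) (hM : Mu.parts = mu.parts.map ((N + 1) * ·))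
    (hN : Nu.parts = nu.parts.map ((N + 1) * ·)) : 0 < kroneckerCoeff ℂ Lam Mu Nu := by
  induction N generalizing m Lam Mu Nu with
  | zero =>
    rwa [kroneckerCoeff_eq_of_parts_eq (a := Lam) (b := Mu) (c := Nu) (a' := lam) (b' := mu)
      (c' := nu)]
    all_goals simp [hL, hM, hN]
  | succ N ih =>
    obtain ⟨Lam', hL'⟩ := exists_parts_eq_map_mul N lam
    obtain ⟨Mu', hM'⟩ := exists_parts_eq_map_mul N mu
    obtain ⟨Nu', hN'⟩ := exists_parts_eq_map_mul N nu
    have ih' := ih hL' hM' hN'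
    have hm : m = (N + 1) * n + n := by
      rw [← Lam.parts_sum, hL, Multiset.sum_map_mul_left, Multiset.map_id', lam.parts_sum]; ring
    subst hm
    have hcard : ∀ {k c : ℕ} {P : Nat.Partition k} {κ : Nat.Partition n},
        P.parts = κ.parts.map (c * ·) → P.parts.card ≤ n := by
      intro k c P κ hP
      rw [hP, Multiset.card_map]
      exact card_parts_le κ
    have hw : ∀ {P : Nat.Partition ((N + 1) * n + n)} {P' : Nat.Partition ((N + 1) * n)}
        {κ : Nat.Partition n}, P.parts = κ.parts.map ((N + 1 + 1) * ·) →
        P'.parts = κ.parts.map ((N + 1) * ·) →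
        Weight.ofPartition n P = Weight.ofPartition n P' + Weight.ofPartition n κ := by
      intro P P' κ hP hP'
      rw [ofPartition_eq_smul_of_parts_eq n hP, ofPartition_eq_smul_of_parts_eq n hP', succ_nsmul]
    exact kroneckerCoeff_pos_of_ofPartition_add n (hcard hL') (hcard hM') (hcard hN')
      (card_parts_le lam) (card_parts_le mu) (card_parts_le nu) (hcard hL) (hcard hM) (hcard hN)
      (hw hL hL') (hw hM hM') (hw hN hN') ih' h

end Stretch

/-! ## §4 Effective Stirling bounds and the limit `N → ∞` -/

section Analysis

open Real

/-- `m log m - m ≤ log m!` (Mathlib's effective Stirling lower bound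
`Stirling.le_log_factorial_stirling`, weakened). [folklore] -/
theorem mul_log_sub_self_le_log_factorial (m : ℕ) :
    (m : ℝ) * Real.log m - m ≤ Real.log (m.factorial : ℕ) := by
  rcases Nat.eq_zero_or_pos m with rfl | hm
  · simp
  · have h := Stirling.le_log_factorial_stirling hm.ne'
    have h1 : 0 ≤ Real.log m := Real.log_natCast_nonneg m
    have h2 : 0 ≤ Real.log (2 * π) := Real.log_nonneg (by linarith [Real.two_le_pi])
    linarith

/-- `log m! ≤ m log m - m + (log m)/2 + 1`, from the antitonicity of Mathlib's Stirling sequence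
`m!/(√(2m) (m/e)^m)` (`Stirling.log_stirlingSeq'_antitone`), whose value at `m = 1` is `e/√2`.
[folklore] -/
theorem log_factorial_le (m : ℕ) :
    Real.log (m.factorial : ℕ) ≤ (m : ℝ) * Real.log m - m + Real.log m / 2 + 1 := by
  rcases Nat.eq_zero_or_pos m with rfl | hm
  · simp
  · obtain ⟨k, rfl⟩ := Nat.exists_eq_succ_of_ne_zero hm.ne'
    have hanti := Stirling.log_stirlingSeq'_antitone (Nat.zero_le k)
    simp only [Function.comp_apply, Nat.succ_eq_add_one, zero_add, Stirling.stirlingSeq_one] at hanti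
    have hform := Stirling.log_stirlingSeq_formula (k + 1)
    have hlog1 : Real.log (Real.exp 1 / √2) = 1 - Real.log 2 / 2 := by
      rw [Real.log_div (Real.exp_pos 1).ne' (by positivity), Real.log_exp,
        Real.log_sqrt (by norm_num : (0 : ℝ) ≤ 2)]
    have hpos : (0 : ℝ) < ((k + 1 : ℕ) : ℝ) := by positivity
    have hlog2 : Real.log (2 * ((k + 1 : ℕ) : ℝ)) = Real.log 2 + Real.log ((k + 1 : ℕ) : ℝ) := by
      rw [Real.log_mul (by norm_num) hpos.ne']
    have hlog3 : Real.log (((k + 1 : ℕ) : ℝ) / Real.exp 1) = Real.log ((k + 1 : ℕ) : ℝ) - 1 := by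
      rw [Real.log_div hpos.ne' (Real.exp_pos 1).ne', Real.log_exp]
    rw [hlog1] at hanti
    rw [hlog2, hlog3] at hform
    linarith

/-- `(x + L) log (x + L) ≤ x log x + L log (x + L) + L` for `x > 0`, `L ≥ 0`, i.e.
`x log (1 + L/x) ≤ L`. [folklore] -/
theorem add_mul_log_add_le {x L : ℝ} (hx : 0 < x) (hL : 0 ≤ L) :
    (x + L) * Real.log (x + L) ≤ x * Real.log x + L * Real.log (x + L) + L := by
  have hxL : 0 < x + L := by linarith
  have h1 : Real.log ((x + L) / x) ≤ (x + L) / x - 1 := Real.log_le_sub_one_of_pos (by positivity)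
  rw [Real.log_div hxL.ne' hx.ne'] at h1
  have h2 : x * (Real.log (x + L) - Real.log x) ≤ x * ((x + L) / x - 1) :=
    mul_le_mul_of_nonneg_left h1 hx.le
  have h3 : x * ((x + L) / x - 1) = L := by field_simp; ring
  rw [h3] at h2
  nlinarith

/-- If `b N ≤ K` for all positive integers `N`, then `b ≤ 0` (Archimedes). [folklore] -/
theorem nonpos_of_mul_natCast_le {b K : ℝ} (h : ∀ N : ℕ, 0 < N → b * N ≤ K) : b ≤ 0 := by
  refine le_of_not_gt fun hb => ?_
  obtain ⟨N, hN⟩ := exists_nat_gt (K / b)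
  have h1 := h (N + 1) (Nat.succ_pos N)
  have h2 : K / b < (N + 1 : ℕ) := hN.trans (by exact_mod_cast Nat.lt_succ_self N)
  rw [div_lt_iff₀ hb] at h2
  push_cast at h1 h2
  linarith

/-- **Sublinear growth of `log`**: if `a N ≤ C log (c N + d) + C'` for all positive integers `N`
(`C ≥ 0`, `c > 0`, `d ≥ 0`), then `a ≤ 0`. Proof: `log y ≤ ε y - 1 - log ε` for every `ε > 0`
(`log (ε y) ≤ ε y - 1`), so `(a - C c ε) N` is bounded and `a ≤ C c ε` for all `ε > 0`. This is
the "`o(N)`" of the printed proof. [folklore] -/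
theorem nonpos_of_mul_natCast_le_log {a C C' c d : ℝ} (hC : 0 ≤ C) (hc : 0 < c) (hd : 0 ≤ d)
    (h : ∀ N : ℕ, 0 < N → a * N ≤ C * Real.log (c * N + d) + C') : a ≤ 0 := by
  have hlin : ∀ ε : ℝ, 0 < ε → a - C * c * ε ≤ 0 := by
    intro ε hε
    refine nonpos_of_mul_natCast_le (K := C * (ε * d - 1 - Real.log ε) + C') fun N hN => ?_
    have hx : 0 < c * N + d := by positivity
    have h1 : Real.log (c * N + d) ≤ ε * (c * N + d) - 1 - Real.log ε := by
      have := Real.log_le_sub_one_of_pos (show 0 < ε * (c * N + d) by positivity)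
      rw [Real.log_mul hε.ne' hx.ne'] at this
      linarith
    have h2 := h N hN
    have h3 : C * Real.log (c * N + d) ≤ C * (ε * (c * N + d) - 1 - Real.log ε) :=
      mul_le_mul_of_nonneg_left h1 hC
    linarith
  rcases eq_or_lt_of_le (mul_nonneg hC hc.le) with h0 | hpos
  · have := hlin 1 one_pos
    rw [← h0] at this
    linarith
  · refine le_of_not_gt fun ha => ?_
    have := hlin (a / (2 * (C * c))) (by positivity)
    have hC0 : C ≠ 0 := by
      rintro rfl
      simp at hpos
    have hc0 : c ≠ 0 := hc.ne'
    have h4 : C * c * (a / (2 * (C * c))) = a / 2 := by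
      field_simp [hC0, hc0]
    rw [h4] at this
    linarith

/-- `∑ᵢ log (N eᵢ)! ≥ N n log N + N ∑ᵢ eᵢ log eᵢ - N n` for positive integers `eᵢ` summing to `n`
(the Stirling lower bound termwise, `log (N eᵢ) = log N + log eᵢ`). [folklore] -/
theorem sum_log_factorial_mul_ge {ι : Type*} [Fintype ι] (e : ι → ℕ) (he : ∀ i, 0 < e i) {N n : ℕ}
    (hN : 0 < N) (hse : ∑ i, (e i : ℝ) = n) :
    (N : ℝ) * n * Real.log N + N * (∑ i, (e i : ℝ) * Real.log (e i)) - N * n ≤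
      ∑ i, Real.log ((N * e i).factorial : ℕ) := by
  have hNr : (0 : ℝ) < N := by exact_mod_cast hN
  have hterm : ∀ i, (N : ℝ) * e i * Real.log N + N * ((e i : ℝ) * Real.log (e i)) - N * e i ≤
      Real.log ((N * e i).factorial : ℕ) := by
    intro i
    have hei : (0 : ℝ) < e i := by exact_mod_cast he i
    have := mul_log_sub_self_le_log_factorial (N * e i)
    have h' : ((N * e i : ℕ) : ℝ) = (N : ℝ) * e i := by push_cast; ring
    rw [h', Real.log_mul hNr.ne' hei.ne'] at this
    linarith
  calc (N : ℝ) * n * Real.log N + N * (∑ i, (e i : ℝ) * Real.log (e i)) - N * n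
      = ∑ i, ((N : ℝ) * e i * Real.log N + N * ((e i : ℝ) * Real.log (e i)) - N * e i) := by
        rw [Finset.sum_sub_distrib, Finset.sum_add_distrib, ← Finset.mul_sum, ← Finset.mul_sum,
          ← Finset.sum_mul, ← Finset.mul_sum, hse]
    _ ≤ ∑ i, Real.log ((N * e i).factorial : ℕ) := Finset.sum_le_sum fun i _ => hterm i

variable {ιa ιb ιc : Type*} [Fintype ιa] [Fintype ιb] [Fintype ιc]

/-- **The limit `N → ∞` of the printed proof of Lemma 3.10.1.** For positive integer families
`a, b, c` summing to `n ≥ 1`, `#a ≤ L`: if `(Nn)! ∏ᵢ (N bᵢ)! ∏ᵢ (N cᵢ)! ≤ (Nn)!² ∏ᵢ (N aᵢ + L)!`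
for all `N ≥ 1` (which is `dim[Na] ≤ dim[Nb] dim[Nc]` combined with the dimension bounds (3.7)),
then `n log n - ∑ᵢ aᵢ log aᵢ ≤ (n log n - ∑ᵢ bᵢ log bᵢ) + (n log n - ∑ᵢ cᵢ log cᵢ)`: by the
Stirling bounds the hypothesis reads `N · (E(a) - E(b) - E(c)) ≤ C log (nN + L) + C'`, and `log`
is sublinear. [cite: ChristandlVranaZuiddam2023, Lemma 3.10 (proof)] -/
theorem entropy_core_le (a : ιa → ℕ) (b : ιb → ℕ) (c : ιc → ℕ) {n L : ℕ} (hn : 0 < n)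
    (ha : ∀ i, 0 < a i) (hb : ∀ i, 0 < b i) (hc : ∀ i, 0 < c i)
    (hsa : ∑ i, a i = n) (hsb : ∑ i, b i = n) (hsc : ∑ i, c i = n) (hLa : Fintype.card ιa ≤ L)
    (hkey : ∀ N : ℕ, 0 < N →
      (N * n).factorial * (∏ i, (N * b i).factorial) * (∏ i, (N * c i).factorial) ≤
        (N * n).factorial ^ 2 * ∏ i, (N * a i + L).factorial) :
    ((n : ℝ) * Real.log n - ∑ i, (a i : ℝ) * Real.log (a i)) ≤
      ((n : ℝ) * Real.log n - ∑ i, (b i : ℝ) * Real.log (b i)) +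
        ((n : ℝ) * Real.log n - ∑ i, (c i : ℝ) * Real.log (c i)) := by
  set TA := ∑ i, (a i : ℝ) * Real.log (a i) with hTA
  set TB := ∑ i, (b i : ℝ) * Real.log (b i) with hTB
  set TC := ∑ i, (c i : ℝ) * Real.log (c i) with hTC
  have hsa' : ∑ i, (a i : ℝ) = n := by exact_mod_cast hsa
  have hsb' : ∑ i, (b i : ℝ) = n := by exact_mod_cast hsb
  have hsc' : ∑ i, (c i : ℝ) = n := by exact_mod_cast hsc
  have hLr : (Fintype.card ιa : ℝ) ≤ L := by exact_mod_cast hLa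
  -- the inequality for each `N ≥ 1`
  have step : ∀ N : ℕ, 0 < N →
      (TB + TC - TA - n * Real.log n) * N ≤
        (1 / 2 + L * (L + 1 / 2)) * Real.log (n * N + L) + (1 + L) := by
    intro N hN
    have hNr : (0 : ℝ) < N := by exact_mod_cast hN
    have hnr : (0 : ℝ) < n := by exact_mod_cast hn
    have hNn : (0 : ℝ) < (N : ℝ) * n := mul_pos hNr hnr
    -- logs of the two sides of `hkey`
    have hf0 : ∀ m : ℕ, ((m.factorial : ℕ) : ℝ) ≠ 0 := fun m => by positivity
    have hlhs : Real.log (((N * n).factorial : ℝ) * (∏ i, ((N * b i).factorial : ℝ)) *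
        ∏ i, ((N * c i).factorial : ℝ)) = Real.log ((N * n).factorial : ℕ) +
          ∑ i, Real.log ((N * b i).factorial : ℕ) + ∑ i, Real.log ((N * c i).factorial : ℕ) := by
      rw [Real.log_mul (by positivity) (by positivity), Real.log_mul (by positivity) (by positivity),
        Real.log_prod (s := Finset.univ) (fun i _ => hf0 _),
        Real.log_prod (s := Finset.univ) (fun i _ => hf0 _)]
    have hrhs : Real.log (((N * n).factorial : ℝ) ^ 2 * ∏ i, ((N * a i + L).factorial : ℝ)) =
        2 * Real.log ((N * n).factorial : ℕ) + ∑ i, Real.log ((N * a i + L).factorial : ℕ) := by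
      rw [Real.log_mul (by positivity) (by positivity), Real.log_pow,
        Real.log_prod (s := Finset.univ) (fun i _ => hf0 _)]
      push_cast
      ring
    have hk2 : Real.log ((N * n).factorial : ℕ) + ∑ i, Real.log ((N * b i).factorial : ℕ) +
        ∑ i, Real.log ((N * c i).factorial : ℕ) ≤
        2 * Real.log ((N * n).factorial : ℕ) + ∑ i, Real.log ((N * a i + L).factorial : ℕ) := by
      rw [← hlhs, ← hrhs]
      exact Real.log_le_log (by positivity) (by exact_mod_cast hkey N hN)
    -- Stirling bounds for the single factorial `(Nn)!`
    have hlogNn : Real.log ((N * n : ℕ) : ℝ) = Real.log N + Real.log n := by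
      push_cast
      rw [Real.log_mul hNr.ne' hnr.ne']
    have hX_lo : (N : ℝ) * n * Real.log N + N * n * Real.log n - N * n ≤
        Real.log ((N * n).factorial : ℕ) := by
      have := mul_log_sub_self_le_log_factorial (N * n)
      rw [hlogNn] at this
      push_cast at this
      linarith
    have hLr0 : (0 : ℝ) ≤ L := Nat.cast_nonneg L
    have hlogle : Real.log ((N * n : ℕ) : ℝ) ≤ Real.log (n * N + L) := by
      refine Real.log_le_log (by positivity) ?_
      push_cast
      linarith [mul_comm (N : ℝ) n]
    have hX_hi : Real.log ((N * n).factorial : ℕ) ≤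
        (N : ℝ) * n * Real.log N + N * n * Real.log n - N * n + Real.log (n * N + L) / 2 + 1 := by
      have := log_factorial_le (N * n)
      rw [hlogNn] at this
      have h' : ((N * n : ℕ) : ℝ) = (N : ℝ) * n := by push_cast; ring
      rw [h'] at this
      linarith
    -- lower bounds for the sums over `b` and `c`
    have hYb := sum_log_factorial_mul_ge b hb hN hsb'
    have hYc := sum_log_factorial_mul_ge c hc hN hsc'
    -- upper bound for the sum over `a`
    have h1n : (1 : ℝ) ≤ n := by exact_mod_cast hn
    have h1N : (1 : ℝ) ≤ N := by exact_mod_cast hN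
    have hlogL : 0 ≤ Real.log (n * N + L) := by
      refine Real.log_nonneg ?_
      have : (1 : ℝ) ≤ n * N := one_le_mul_of_one_le_of_one_le h1n h1N
      linarith
    have hZa : ∑ i, Real.log ((N * a i + L).factorial : ℕ) ≤
        (N : ℝ) * n * Real.log N + N * TA - N * n + L * ((L + 1 / 2) * Real.log (n * N + L) + 1) := by
      have hterm : ∀ i, Real.log ((N * a i + L).factorial : ℕ) ≤
          (N : ℝ) * a i * Real.log N + N * ((a i : ℝ) * Real.log (a i)) - N * a i +
            ((L + 1 / 2) * Real.log (n * N + L) + 1) := by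
        intro i
        have hai : (0 : ℝ) < a i := by exact_mod_cast ha i
        have hx : (0 : ℝ) < N * a i := mul_pos hNr hai
        have h1 := log_factorial_le (N * a i + L)
        have h' : ((N * a i + L : ℕ) : ℝ) = (N : ℝ) * a i + L := by push_cast; ring
        rw [h'] at h1
        have h2 := add_mul_log_add_le hx hLr0
        rw [Real.log_mul hNr.ne' hai.ne'] at h2
        -- `N aᵢ + L ≤ n N + L`
        have hale : (a i : ℝ) ≤ n := by
          have : a i ≤ ∑ j, a j := Finset.single_le_sum (fun j _ => Nat.zero_le _) (Finset.mem_univ i)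
          rw [hsa] at this
          exact_mod_cast this
        have h3 : Real.log ((N : ℝ) * a i + L) ≤ Real.log (n * N + L) := by
          refine Real.log_le_log (by positivity) ?_
          have := mul_le_mul_of_nonneg_left hale hNr.le
          linarith [mul_comm (N : ℝ) n]
        have h4 : 0 ≤ Real.log ((N : ℝ) * a i + L) := by
          refine Real.log_nonneg ?_
          have h1' : (1 : ℝ) ≤ a i := by exact_mod_cast ha i
          have : (1 : ℝ) ≤ N * a i := one_le_mul_of_one_le_of_one_le h1N h1'
          linarith
        have h5 : ((L : ℝ) + 1 / 2) * Real.log ((N : ℝ) * a i + L) ≤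
            (L + 1 / 2) * Real.log (n * N + L) :=
          mul_le_mul_of_nonneg_left h3 (by positivity)
        linarith
      calc ∑ i, Real.log ((N * a i + L).factorial : ℕ)
          ≤ ∑ i, ((N : ℝ) * a i * Real.log N + N * ((a i : ℝ) * Real.log (a i)) - N * a i +
              ((L + 1 / 2) * Real.log (n * N + L) + 1)) := Finset.sum_le_sum fun i _ => hterm i
        _ = (N : ℝ) * n * Real.log N + N * TA - N * n +
              Fintype.card ιa * ((L + 1 / 2) * Real.log (n * N + L) + 1) := by
            rw [Finset.sum_add_distrib, Finset.sum_sub_distrib, Finset.sum_add_distrib,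
              ← Finset.mul_sum, ← Finset.mul_sum, ← Finset.sum_mul, ← Finset.mul_sum, hsa',
              Finset.sum_const, Finset.card_univ, nsmul_eq_mul]
        _ ≤ (N : ℝ) * n * Real.log N + N * TA - N * n +
              L * ((L + 1 / 2) * Real.log (n * N + L) + 1) := by
            have h0 : (0 : ℝ) ≤ (L + 1 / 2) * Real.log (n * N + L) + 1 := by positivity
            have := mul_le_mul_of_nonneg_right hLr h0
            linarith
    -- combine
    linarith
  -- conclude with the sublinearity of `log`
  have hfin := nonpos_of_mul_natCast_le_log (a := TB + TC - TA - n * Real.log n)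
    (C := 1 / 2 + L * (L + 1 / 2)) (C' := 1 + L) (c := n) (d := L) (by positivity)
    (by exact_mod_cast hn) (Nat.cast_nonneg L) step
  linarith

end Analysis

/-! ## §5 The entropy of a partition, expanded; the printed route assembled -/

section Main

/-- A multiset product as a product over the multiset coerced to a type. [folklore] -/
theorem multiset_map_prod_eq_prod_coe {α β : Type*} [DecidableEq α] [CommMonoid β] (m : Multiset α)
    (g : α → β) : (m.map g).prod = ∏ x : m, g (x : α) := by
  rw [← Multiset.map_univ m g, ← Finset.prod_eq_multiset_prod]

/-- A multiset sum as a sum over the multiset coerced to a type (any additive commutative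
monoid; `multiset_map_sum_eq_sum_coe` of `QuantumFunctionalsUpper.lean` is the real case).
[folklore] -/
theorem multiset_map_sum_eq_sum_coe' {α β : Type*} [DecidableEq α] [AddCommMonoid β]
    (m : Multiset α) (g : α → β) : (m.map g).sum = ∑ x : m, g (x : α) := by
  rw [← Multiset.map_univ m g, ← Finset.sum_eq_multiset_sum]

/-- `H(κ̄) = (n log n - ∑ᵢ κᵢ log κᵢ)/(n log 2)` for `κ ⊢ n`, `n ≥ 1` (the entropy of the
normalised partition in bits, `-∑ (κᵢ/n) log₂ (κᵢ/n)`, expanded). [folklore] -/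
theorem partitionEntropy_eq_div {n : ℕ} (hn : 0 < n) (κ : Nat.Partition n) :
    partitionEntropy κ = ((n : ℝ) * Real.log n -
      ∑ x : κ.parts, ((x : ℕ) : ℝ) * Real.log ((x : ℕ) : ℝ)) / (n * Real.log 2) := by
  classical
  have hnr : (0 : ℝ) < n := by exact_mod_cast hn
  have hsum : ∑ x : κ.parts, (((x : ℕ) : ℝ)) = n := by
    rw [← multiset_map_sum_eq_sum_coe' κ.parts (fun p : ℕ => (p : ℝ)), ← Nat.cast_multiset_sum,
      κ.parts_sum]
  have hterm : ∀ x : κ.parts, Real.negMulLog ((((x : ℕ) : ℝ)) / n) =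
      (((x : ℕ) : ℝ) * Real.log n - ((x : ℕ) : ℝ) * Real.log ((x : ℕ) : ℝ)) / n := by
    intro x
    have hx : (0 : ℝ) < ((x : ℕ) : ℝ) := by exact_mod_cast κ.parts_pos (Multiset.coe_mem (x := x))
    rw [Real.negMulLog, Real.log_div hx.ne' hnr.ne']
    field_simp
    ring
  rw [partitionEntropy_def, multiset_map_sum_eq_sum_coe, Finset.sum_congr rfl fun x _ => hterm x,
    ← Finset.sum_div, Finset.sum_sub_distrib, ← Finset.sum_mul, hsum, div_div]

/-- **The printed route, assembled**: `dim[Nλ] ≤ dim[Nμ] dim[Nν]` and the dimension bounds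
(3.7) give, for `g_{λ,μ,ν} ≠ 0` (the tree's `kroneckerCoeff ℂ μ ν λ`, multiplicity of `[λ]` in
`[μ] ⊗ [ν]`) and every `N ≥ 1`, the division-free inequality
`(Nn)! ∏ᵢ (Nμᵢ)! ∏ᵢ (Nνᵢ)! ≤ (Nn)!² ∏ᵢ (Nλᵢ + n)!` — the input of `entropy_core_le`.
[cite: ChristandlVranaZuiddam2023, Lemma 3.10 (proof)] -/
theorem factorial_mul_prod_le_of_kroneckerCoeff_ne_zero {n : ℕ} {lam mu nu : Nat.Partition n}
    (hg : kroneckerCoeff ℂ mu nu lam ≠ 0) {N : ℕ} (hN : 0 < N) :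
    (N * n).factorial * (mu.parts.map fun q => (N * q).factorial).prod *
        (nu.parts.map fun q => (N * q).factorial).prod ≤
      (N * n).factorial ^ 2 * (lam.parts.map fun q => (N * q + n).factorial).prod := by
  have hgpos : 0 < kroneckerCoeff ℂ mu nu lam := Nat.pos_of_ne_zero hg
  obtain ⟨M, rfl⟩ := Nat.exists_eq_succ_of_ne_zero hN.ne'
  obtain ⟨Lam, hL⟩ := exists_parts_eq_map_mul M lam
  obtain ⟨Mu, hM⟩ := exists_parts_eq_map_mul M mu
  obtain ⟨Nu, hN⟩ := exists_parts_eq_map_mul M nu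
  have hpos := kroneckerCoeff_pos_of_parts_eq_map_mul hgpos M hM hN hL
  have h1 := numStandardTableaux_le_mul_of_kroneckerCoeff_ne_zero hpos.ne'
  have h2 := factorial_le_numStandardTableaux_mul_prod Lam (L := n)
    (by rw [hL, Multiset.card_map]; exact card_parts_le lam)
  have h3 := numStandardTableaux_mul_prod_factorial_le Mu
  have h4 := numStandardTableaux_mul_prod_factorial_le Nu
  rw [hL, Multiset.map_map] at h2
  rw [hM, Multiset.map_map] at h3
  rw [hN, Multiset.map_map] at h4
  simp only [Function.comp_def, Nat.succ_eq_add_one] at h2 h3 h4 ⊢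
  set A := (lam.parts.map fun q => ((M + 1) * q + n).factorial).prod
  set B := (mu.parts.map fun q => ((M + 1) * q).factorial).prod
  set C := (nu.parts.map fun q => ((M + 1) * q).factorial).prod
  set F := ((M + 1) * n).factorial
  set fL := numStandardTableaux Lam
  set fM := numStandardTableaux Mu
  set fN := numStandardTableaux Nu
  calc F * B * C ≤ (fL * A) * B * C := by gcongr
    _ ≤ (fM * fN * A) * B * C := by gcongr
    _ = (fM * B) * (fN * C) * A := by ring
    _ ≤ F * F * A := by gcongr
    _ = F ^ 2 * A := by ring

/-- **Lemma 3.10.1 along the printed route** (semigroup property, `dim[Nλ] ≤ dim[Nμ] dim[Nν]`,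
dimension bounds (3.7), `N → ∞`): `g_{λ,μ,ν} ≠ 0 ⇒ n log n - ∑ λᵢ log λᵢ ≤
(n log n - ∑ μᵢ log μᵢ) + (n log n - ∑ νᵢ log νᵢ)`, i.e. `H(λ̄) ≤ H(μ̄) + H(ν̄)` up to the factor
`n log 2` (`partitionEntropy_eq_div`). The named fact itself is discharged (by a different,
elementary argument) in `QuantumFunctionalsUpperKroneckerEntropyProofs.lean`; this theorem is the
printed proof and is kept in unnormalised form so as not to duplicate that declaration.
[cite: ChristandlVranaZuiddam2023, Lemma 3.10.1 (proof)] -/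
theorem entropy_le_add_of_kroneckerCoeff_ne_zero {n : ℕ} (hn : 0 < n)
    {lam mu nu : Nat.Partition n} (hg : kroneckerCoeff ℂ mu nu lam ≠ 0) :
    ((n : ℝ) * Real.log n - ∑ x : lam.parts, ((x : ℕ) : ℝ) * Real.log ((x : ℕ) : ℝ)) ≤
      ((n : ℝ) * Real.log n - ∑ x : mu.parts, ((x : ℕ) : ℝ) * Real.log ((x : ℕ) : ℝ)) +
        ((n : ℝ) * Real.log n - ∑ x : nu.parts, ((x : ℕ) : ℝ) * Real.log ((x : ℕ) : ℝ)) := by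
  classical
  have hkey : ∀ N : ℕ, 0 < N →
      (N * n).factorial * (∏ x : mu.parts, (N * (x : ℕ)).factorial) *
        (∏ x : nu.parts, (N * (x : ℕ)).factorial) ≤
      (N * n).factorial ^ 2 * ∏ x : lam.parts, (N * (x : ℕ) + n).factorial := by
    intro N hN
    have := factorial_mul_prod_le_of_kroneckerCoeff_ne_zero hg hN
    rwa [multiset_map_prod_eq_prod_coe, multiset_map_prod_eq_prod_coe,
      multiset_map_prod_eq_prod_coe] at this
  have hsumc : ∀ κ : Nat.Partition n, ∑ x : κ.parts, (x : ℕ) = n := fun κ => by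
    rw [← multiset_map_sum_eq_sum_coe' κ.parts (fun p : ℕ => p), Multiset.map_id', κ.parts_sum]
  have hposc : ∀ (κ : Nat.Partition n) (x : κ.parts), 0 < (x : ℕ) := fun κ x =>
    κ.parts_pos (Multiset.coe_mem (x := x))
  exact entropy_core_le (fun x : lam.parts => (x : ℕ)) (fun x : mu.parts => (x : ℕ))
    (fun x : nu.parts => (x : ℕ)) (L := n) hn (hposc lam) (hposc mu) (hposc nu) (hsumc lam)
    (hsumc mu) (hsumc nu) (by rw [Multiset.card_coe]; exact card_parts_le lam) hkey

end Main

end Literature.Computability.AlgebraicComplexity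

end
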